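import Mathlib
import HarnessLib
import Literature.NumberTheory.DiophantineGeometry.BelyiPairDescent

/-!
# The ascent step: from a deep Gauss point whose outer class is not a pole

(Layer 3c of the bad-prime floor for the Belyi degree; mirror image of `BelyiPairDescent`.)

* `IsBelyiPair.outer_entering` — if `∞` is not a pole of the reduction, some shift `p - (a + bt) q`
  has fewer integral roots than `q`;
* `IsBelyiPair.exists_special_not_mem` — a deep pair has a special point outside the unit disc;
* `IsBelyiPair.edge_invariant_up`, `IsBelyiPair.ascend` — **the ascent step**: the rescaled pair on
  the next cluster disc up is again deep.

Folklore (cf. Zannier, Israel J. Math. 124 (2001)); everything proved, no named facts.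
-/

noncomputable section

namespace Literature.NumberTheory.DiophantineGeometry

open Polynomial IsLocalRing Literature.RingTheory.Valuation
open scoped Classical

section Ascend

variable {K : Type*} [Field K] [IsAlgClosed K] [CharZero K] (A : ValuationSubring K)
variable {d : ℕ} {p q : K[X]}

omit [CharZero K] in
/-- **Outer entering lemma.**  If `∞` is not a pole of the reduction `redPoly (p - a q)/redPoly q`
(`#intRoots (p - a q) ≤ #intRoots q`), then for a suitable `t` the polynomial `p - (a + b t) q` has
strictly FEWER integral roots than `q` (more of its roots are in the outer class). [folklore] -/
theorem IsBelyiPair.outer_entering (h : IsBelyiPair d p q) {b c₁ : K} {gP gQ : A[X]}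
    {u : ResidueField A} (hu : u ≠ 0)
    (hgPf : gP.map (algebraMap A K) = C c₁ * (p - C (centre A p q) * q))
    (hgPr : gP.map (residue A) = redPoly A (p - C (centre A p q) * q))
    (hgQf : gQ.map (algebraMap A K) = C (c₁ * b) * q) (hgQr : gQ.map (residue A) = C u * redPoly A q)
    (houter : Multiset.card (intRoots A (p - C (centre A p q) * q)) ≤ Multiset.card (intRoots A q)) :
    ∃ t : A, Multiset.card (intRoots A (p - C (centre A p q + b * t) * q)) <
      Multiset.card (intRoots A q) := by
  set a := centre A p q with ha
  set Pt := redPoly A (p - C a * q) with hPt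
  set Qt := redPoly A q with hQt
  have hdP : Pt.natDegree = Multiset.card (intRoots A (p - C a * q)) := natDegree_redPoly A _
  have hdQ : Qt.natDegree = Multiset.card (intRoots A q) := natDegree_redPoly A _
  -- the value at `∞`: `0` if `deg Pt < deg Qt`, the leading-coefficient ratio `u⁻¹` otherwise
  set w : ResidueField A := if Pt.natDegree < Qt.natDegree then 0 else u⁻¹ with hw
  obtain ⟨t, ht⟩ := residue_surjective (R := A) w
  refine ⟨t, ?_⟩
  obtain ⟨hf, hr⟩ := chart_shift A hgPf hgPr hgQf hgQr t
  have hne : (gP - C t * gQ).map (residue A) ≠ 0 := by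
    rw [hr]; exact h.redPoly_sub_C_mul_redPoly_ne_zero A _
  rw [← natDegree_map_residue_eq_card_intRoots (IsAlgClosed.splits _) hf hne, hr, ← hdQ, ht]
  -- `deg (Pt - (w u) Qt) < deg Qt`
  by_cases hlt : Pt.natDegree < Qt.natDegree
  · rw [hw, if_pos hlt, zero_mul, C_0, zero_mul, sub_zero]; exact hlt
  · have heq : Pt.natDegree = Qt.natDegree := by omega
    rw [hw, if_neg hlt, inv_mul_cancel₀ hu, C_1, one_mul]
    have hPt0 : Pt ≠ 0 := (monic_redPoly A _).ne_zero
    have hQt0 : Qt ≠ 0 := (monic_redPoly A _).ne_zero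
    have hne' : Pt - Qt ≠ 0 := by
      have := h.redPoly_sub_C_mul_redPoly_ne_zero A (1 : ResidueField A)
      rwa [C_1, one_mul] at this
    have hdeg : Pt.degree = Qt.degree := by
      rw [degree_eq_natDegree hPt0, degree_eq_natDegree hQt0, heq]
    have hlc : Pt.leadingCoeff = Qt.leadingCoeff := by
      rw [(monic_redPoly A (p - C a * q)).leadingCoeff, (monic_redPoly A q).leadingCoeff]
    rw [← heq]
    exact natDegree_lt_natDegree hne' (degree_sub_lt hdeg hPt0 hlc)

omit [CharZero K] in
/-- At a deep pair some special point lies outside the unit disc. [folklore] -/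
theorem IsBelyiPair.exists_special_not_mem (h : IsBelyiPair d p q) (hdeep : IsDeepPair A p q) :
    ∃ s ∈ (p * q * (p - q)).roots, s ∉ A := by
  by_contra hall
  push Not at hall
  have hint : ∀ {f : K[X]}, (∀ s ∈ f.roots, s ∈ A) → Multiset.card (intRoots A f) = f.natDegree := by
    intro f hf
    rw [card_intRoots, Multiset.filter_eq_self.mpr hf]
    exact ((IsAlgClosed.splits f).natDegree_eq_card_roots).symm
  have hp : ∀ s ∈ p.roots, s ∈ A := fun s hs => hall s (by
    rw [h.roots_prod]; exact Multiset.mem_add.mpr (Or.inl (Multiset.mem_add.mpr (Or.inl hs))))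
  have hq : ∀ s ∈ q.roots, s ∈ A := fun s hs => hall s (by
    rw [h.roots_prod]; exact Multiset.mem_add.mpr (Or.inl (Multiset.mem_add.mpr (Or.inr hs))))
  have hr : ∀ s ∈ (p - q).roots, s ∈ A := fun s hs => hall s (by
    rw [h.roots_prod]; exact Multiset.mem_add.mpr (Or.inr hs))
  have e1 := IsDeepPair.card_intRoots_left_eq A hdeep
  have e2 := IsDeepPair.card_intRoots_sub_eq A hdeep
  rw [hint hp, hint hq] at e1
  rw [hint hr, hint hq] at e2
  have hmax := h.natDegree_eq
  rcases h.drop with h' | h' | h' <;> omega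

/-- **The edge invariant (upward).**  Mirror image of `edge_invariant`: on the edge from the unit
disc around `s₀` up to the next cluster radius `γ'`, the OPEN root counts of `P' = p - aₛ q` stay
`≤ ν - 1` (`ν` the number of poles in the unit disc) and the dominant Taylor coefficient stays
bounded. [folklore] -/
theorem IsBelyiPair.edge_invariant_up (h : IsBelyiPair d p q)
    (htame : ∀ n : ℕ, 0 < n → n ≤ d → (n : ResidueField A) ≠ 0) {s₀ : K}
    {γ' : A.ValueGroup}
    (hspec : ∀ s ∈ (p * q * (p - q)).roots, 1 < A.valuation (s - s₀) → γ' ≤ A.valuation (s - s₀))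
    {ν : ℕ} (hν : ν = rootsIn A q s₀ 1) (hν0 : 0 < ν)
    {aₛ : K} (haₛ : aₛ = (taylor s₀ p).coeff ν / (taylor s₀ q).coeff ν)
    {k : ℕ} (hk : k = rootsIn A (p - C aₛ * q) s₀ 1) (hkν : k + 1 ≤ ν)
    {θ : A.ValueGroup}
    (hθ : A.valuation ((taylor s₀ (p - C aₛ * q)).coeff k) ≤ θ * A.valuation ((taylor s₀ q).coeff ν))
    (hθY : θ < rY A aₛ) {c : K} (hc1 : 1 < A.valuation c) (hcγ' : A.valuation c ≤ γ') :
    rootsInOpen A (p - C aₛ * q) s₀ (A.valuation c) + 1 ≤ ν ∧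
      A.valuation ((taylor s₀ (p - C aₛ * q)).coeff (rootsInOpen A (p - C aₛ * q) s₀ (A.valuation c))) ≤
        θ * A.valuation ((taylor s₀ q).coeff ν) := by
  set P' := p - C aₛ * q with hP'
  have hP'0 : P' ≠ 0 := h.sub_C_mul_ne_zero aₛ
  have hq0 : q ≠ 0 := h.right_ne_zero
  have hpoles : ∀ β ∈ q.roots, 1 < A.valuation (β - s₀) → γ' ≤ A.valuation (β - s₀) := by
    intro β hβ
    refine hspec β ?_
    rw [h.roots_prod]
    exact Multiset.mem_add.mpr (Or.inl (Multiset.mem_add.mpr (Or.inr hβ)))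
  -- pole counts: closed count `ν` on `[1, γ')`, open count `ν` on `(1, γ']`
  have hrq : ∀ {e : K}, 1 ≤ A.valuation e → A.valuation e < γ' → rootsIn A q s₀ (A.valuation e) = ν := by
    intro e he1 heγ
    rw [hν, rootsIn, rootsIn]
    congr 1
    refine Multiset.filter_congr fun β hβ => ⟨fun hle => ?_, fun hle => hle.trans he1⟩
    by_contra hgt
    exact absurd ((hpoles β hβ (not_le.mp hgt)).trans hle) (not_le.mpr heγ)
  have hrqo : ∀ {e : K}, 1 < A.valuation e → A.valuation e ≤ γ' → rootsInOpen A q s₀ (A.valuation e) = ν := by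
    intro e he1 heγ
    rw [hν, rootsInOpen, rootsIn]
    congr 1
    refine Multiset.filter_congr fun β hβ => ⟨fun hlt => ?_, fun hle => lt_of_le_of_lt hle he1⟩
    by_contra hgt
    exact absurd (heγ.trans (hpoles β hβ (not_le.mp hgt))) (not_le.mpr hlt)
  have hQν : ∀ {e : K}, e ≠ 0 → 1 ≤ A.valuation e → A.valuation e < γ' →
      A.valuation ((taylor s₀ q).coeff ν) * A.valuation e ^ ν = gaussValAt A q s₀ (A.valuation e) := by
    intro e he he1 heγ
    have := valuation_taylor_coeff_rootsIn (A := A) hq0 (IsAlgClosed.splits q) s₀ he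
    rwa [hrq he1 heγ] at this
  have hQν0 : A.valuation ((taylor s₀ q).coeff ν) ≠ 0 := by
    intro h0
    have := hQν (one_ne_zero) (by rw [map_one]) (by rw [map_one]; exact lt_of_lt_of_le hc1 hcγ')
    rw [h0, zero_mul, ← gaussVal_comp] at this
    exact gaussVal_ne_zero A (comp_C_add_C_mul_X_ne_zero hq0 s₀ one_ne_zero) this.symm
  have hcentre : ∀ {e : K}, e ≠ 0 → 1 ≤ A.valuation e → A.valuation e < γ' →
      centre A (p.comp (C s₀ + C e * X)) (q.comp (C s₀ + C e * X)) = aₛ := by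
    intro e he he1 heγ
    rw [centre_comp A p q s₀ he, hrq he1 heγ, haₛ]
  -- strong induction on the number of roots of `P'` with `1 < v(τ - s₀) < v e`
  suffices key : ∀ (N : ℕ) (e : K), 1 < A.valuation e → A.valuation e ≤ γ' →
      rootsInOpen A P' s₀ (A.valuation e) - k = N →
      rootsInOpen A P' s₀ (A.valuation e) + 1 ≤ ν ∧
        A.valuation ((taylor s₀ P').coeff (rootsInOpen A P' s₀ (A.valuation e))) ≤
          θ * A.valuation ((taylor s₀ q).coeff ν) from key _ c hc1 hcγ' rfl
  intro N
  induction N using Nat.strong_induction_on with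
  | _ N ih =>
  intro e he1 heγ hN
  have he0 : e ≠ 0 := by
    intro h0; rw [h0, map_zero] at he1; exact (not_lt.mpr zero_le) he1
  have hk_le : k ≤ rootsInOpen A P' s₀ (A.valuation e) := by
    rw [hk, rootsIn, rootsInOpen]
    exact Multiset.card_le_card (Multiset.monotone_filter_right _ fun β hβ => lt_of_le_of_lt hβ he1)
  by_cases hN0 : N = 0
  · have hEq : rootsInOpen A P' s₀ (A.valuation e) = k := by omega
    rw [hEq]
    exact ⟨hkν, hθ⟩
  · -- the nearest breakpoint `β` below `v e`
    have hexists : ∃ τ ∈ P'.roots, 1 < A.valuation (τ - s₀) ∧ A.valuation (τ - s₀) < A.valuation e := by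
      by_contra hnone
      push Not at hnone
      have : rootsInOpen A P' s₀ (A.valuation e) = k := by
        rw [hk, rootsIn, rootsInOpen]
        congr 1
        refine Multiset.filter_congr fun τ hτ => ⟨fun hlt => ?_, fun hle => lt_of_le_of_lt hle he1⟩
        by_contra hgt
        exact absurd (hnone τ hτ (not_le.mp hgt)) (not_le.mpr hlt)
      omega
    obtain ⟨τ₀, hτ₀, hτ₀max⟩ := Finset.exists_max_image
      ((P'.roots.toFinset).filter fun τ => 1 < A.valuation (τ - s₀) ∧ A.valuation (τ - s₀) < A.valuation e)
      (fun τ => A.valuation (τ - s₀))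
      (by obtain ⟨τ, hτ, h1, h2⟩ := hexists
          exact ⟨τ, Finset.mem_filter.mpr ⟨Multiset.mem_toFinset.mpr hτ, h1, h2⟩⟩)
    rw [Finset.mem_filter, Multiset.mem_toFinset] at hτ₀
    obtain ⟨hτ₀r, hβ1, hβe⟩ := hτ₀
    set cβ : K := τ₀ - s₀ with hcβ
    have hcβ0 : cβ ≠ 0 := by
      intro h0; rw [h0, map_zero] at hβ1; exact (not_lt.mpr zero_le) hβ1
    have hβγ : A.valuation cβ < γ' := lt_of_lt_of_le hβe heγ
    have hmax : ∀ τ ∈ P'.roots, 1 < A.valuation (τ - s₀) → A.valuation (τ - s₀) < A.valuation e →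
        A.valuation (τ - s₀) ≤ A.valuation cβ := fun τ hτ h1 h2 =>
      hτ₀max τ (Finset.mem_filter.mpr ⟨Multiset.mem_toFinset.mpr hτ, h1, h2⟩)
    -- counts at `β`: open `k₁`, closed `k₂ = rootsInOpen (v e)`
    set k₁ := rootsInOpen A P' s₀ (A.valuation cβ) with hk₁
    set k₂ := rootsIn A P' s₀ (A.valuation cβ) with hk₂
    have hk₂e : k₂ = rootsInOpen A P' s₀ (A.valuation e) := by
      rw [hk₂, rootsIn, rootsInOpen]
      congr 1
      refine Multiset.filter_congr fun τ hτ => ⟨fun hle => lt_of_le_of_lt hle hβe, fun hlt => ?_⟩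
      by_contra hgt
      rw [not_le] at hgt
      exact absurd (hmax τ hτ (lt_trans hβ1 hgt) hlt) (not_le.mpr hgt)
    have hk₁lt : k₁ < k₂ := by
      rw [hk₁, hk₂, rootsIn, rootsInOpen]
      apply Multiset.card_lt_card
      refine lt_of_le_of_ne (Multiset.monotone_filter_right _ fun τ hτ => hτ.le) fun heq => ?_
      have hmem : τ₀ ∈ P'.roots.filter fun α => A.valuation (α - s₀) ≤ A.valuation cβ :=
        Multiset.mem_filter.mpr ⟨hτ₀r, le_rfl⟩
      rw [← heq, Multiset.mem_filter] at hmem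
      exact lt_irrefl _ hmem.2
    have hk_k₁ : k ≤ k₁ := by
      rw [hk, hk₁, rootsIn, rootsInOpen]
      exact Multiset.card_le_card (Multiset.monotone_filter_right _ fun β hβ => lt_of_le_of_lt hβ hβ1)
    -- induction hypothesis at `β`
    have hIH := ih (k₁ - k) (by omega) cβ hβ1 hβγ.le rfl
    rw [← hk₁] at hIH
    obtain ⟨hk₁ν, hθk₁⟩ := hIH
    -- Gauss values at `β`
    have hG₁ : A.valuation ((taylor s₀ P').coeff k₁) * A.valuation cβ ^ k₁ =
        gaussValAt A P' s₀ (A.valuation cβ) := by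
      rw [hk₁]; exact valuation_taylor_coeff_rootsInOpen hP'0 (IsAlgClosed.splits _) s₀ hcβ0
    have hG₂ : A.valuation ((taylor s₀ P').coeff k₂) * A.valuation cβ ^ k₂ =
        gaussValAt A P' s₀ (A.valuation cβ) := by
      rw [hk₂]; exact valuation_taylor_coeff_rootsIn hP'0 (IsAlgClosed.splits _) s₀ hcβ0
    have hvβ : 0 < A.valuation cβ := lt_trans zero_lt_one hβ1
    -- coefficient bound propagates upward: `v(P'_{k₂}) = v(P'_{k₁}) β^{k₁} / β^{k₂} ≤ v(P'_{k₁})`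
    have hcoeff₂ : A.valuation ((taylor s₀ P').coeff k₂) ≤ θ * A.valuation ((taylor s₀ q).coeff ν) := by
      have e1 : A.valuation ((taylor s₀ P').coeff k₂) * A.valuation cβ ^ (k₂ - k₁) * A.valuation cβ ^ k₁ =
          A.valuation ((taylor s₀ P').coeff k₁) * A.valuation cβ ^ k₁ := by
        rw [hG₁, ← hG₂, mul_assoc, ← pow_add, Nat.sub_add_cancel hk₁lt.le]
      have e2 : A.valuation ((taylor s₀ P').coeff k₂) * A.valuation cβ ^ (k₂ - k₁) =
          A.valuation ((taylor s₀ P').coeff k₁) :=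
        mul_right_cancel₀ (pow_ne_zero k₁ hvβ.ne') e1
      have hge : 1 ≤ A.valuation cβ ^ (k₂ - k₁) := one_le_pow₀ hβ1.le
      calc A.valuation ((taylor s₀ P').coeff k₂)
          ≤ A.valuation ((taylor s₀ P').coeff k₂) * A.valuation cβ ^ (k₂ - k₁) :=
            le_mul_of_one_le_right' hge
        _ = A.valuation ((taylor s₀ P').coeff k₁) := e2
        _ ≤ _ := hθk₁
    -- the rescaled pair at `β` is deep
    have hpairβ := h.comp s₀ hcβ0
    set Lβ : K[X] := C s₀ + C cβ * X with hLβ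
    have hPLβ : P'.comp Lβ = p.comp Lβ - C aₛ * q.comp Lβ := sub_C_mul_comp p q aₛ Lβ
    have hdeepβ : IsDeepPair A (p.comp Lβ) (q.comp Lβ) := by
      refine ⟨aₛ, ?_⟩
      rw [← hPLβ, hLβ, gaussVal_comp, gaussVal_comp, ← hG₁, ← hQν hcβ0 hβ1.le hβγ]
      have hle1 : A.valuation cβ ^ k₁ ≤ A.valuation cβ ^ ν := pow_le_pow_right₀ hβ1.le (by omega)
      have hpos : 0 < A.valuation ((taylor s₀ q).coeff ν) * A.valuation cβ ^ ν :=
        mul_pos (zero_lt_iff.mpr hQν0) (pow_pos hvβ ν)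
      calc A.valuation ((taylor s₀ P').coeff k₁) * A.valuation cβ ^ k₁
          ≤ θ * A.valuation ((taylor s₀ q).coeff ν) * A.valuation cβ ^ k₁ := mul_le_mul' hθk₁ le_rfl
        _ ≤ θ * A.valuation ((taylor s₀ q).coeff ν) * A.valuation cβ ^ ν := mul_le_mul' le_rfl hle1
        _ = θ * (A.valuation ((taylor s₀ q).coeff ν) * A.valuation cβ ^ ν) := by rw [mul_assoc]
        _ < rY A aₛ * (A.valuation ((taylor s₀ q).coeff ν) * A.valuation cβ ^ ν) :=
            mul_lt_mul_of_pos_right hθY hpos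
    -- the all-shallow contradiction at `β`: inner class `0` IS shallow (`k₁ < ν`), so `∞` is not:
    -- `k₂ ≤ ν`
    have hk₂ν : k₂ ≤ ν := by
      by_contra hlt
      rw [not_le] at hlt
      refine hpairβ.false_of_forall_shallow A htame hdeepβ (v₀ := 0) ?_ ?_ ?_
      · rw [hLβ, count_redRoots_comp_zero q s₀ hcβ0, hrqo hβ1 hβγ.le]; exact hν0
      · intro w hw
        by_cases hw0 : w = 0
        · subst hw0
          rw [hcentre hcβ0 hβ1.le hβγ, ← hPLβ, hLβ, rootMultiplicity_zero_redPoly_comp A _ _ hcβ0,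
            rootMultiplicity_zero_redPoly_comp A _ _ hcβ0, hrqo hβ1 hβγ.le]
          omega
        · exfalso
          rw [hLβ, count_redRoots_comp_eq_zero A q s₀ hcβ0 ?_ hw0] at hw
          · exact lt_irrefl 0 hw
          · intro α hα hle
            by_contra hge
            rw [not_lt] at hge
            have h1 : 1 < A.valuation (α - s₀) := lt_of_lt_of_le hβ1 hge
            exact absurd ((hpoles α hα h1).trans hle) (not_le.mpr hβγ)
      · rw [hcentre hcβ0 hβ1.le hβγ, ← hPLβ, hLβ, card_intRoots_comp_eq_rootsIn q s₀ hcβ0,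
          card_intRoots_comp_eq_rootsIn P' s₀ hcβ0, hrq hβ1.le hβγ]
        exact hlt
    -- non-constancy strictly between `β` and `v e` forbids `k₂ = ν`
    have hk₂ne : k₂ ≠ ν := by
      intro heq
      obtain ⟨γ, hβγ'', hγe⟩ := exists_between_of_lt A hvβ.ne' hβe
      obtain ⟨e', he'⟩ := A.valuation_surjective γ
      rw [← he'] at hβγ'' hγe
      have he'0 : e' ≠ 0 := by
        intro h0; rw [h0, map_zero] at hβγ''; exact (not_lt.mpr zero_le) hβγ''
      have he'1 : 1 < A.valuation e' := lt_trans hβ1 hβγ''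
      have he'γ : A.valuation e' < γ' := lt_of_lt_of_le hγe heγ
      have hcount : rootsIn A P' s₀ (A.valuation e') = k₂ := by
        rw [hk₂e, rootsIn, rootsInOpen]
        congr 1
        refine Multiset.filter_congr fun τ hτ => ⟨fun hle => lt_of_le_of_lt hle hγe, fun hlt => ?_⟩
        by_contra hgt
        rw [not_le] at hgt
        exact absurd (hmax τ hτ (lt_trans he'1 hgt) hlt) (not_le.mpr (lt_trans hβγ'' hgt))
      have hpair' := h.comp s₀ he'0
      have hopt := (hpair'.optimal_centre A rfl rfl).2
      rw [← centre, hcentre he'0 he'1.le he'γ, ← sub_C_mul_comp, redPoly_comp_eq_X_pow A P' s₀ he'0,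
        redPoly_comp_eq_X_pow A q s₀ he'0, hcount, hrq he'1.le he'γ, heq] at hopt
      · exact hopt rfl
      · intro α hα hle
        by_contra hge
        rw [not_lt] at hge
        have h1 : 1 < A.valuation (α - s₀) := lt_of_lt_of_le he'1 hge
        exact absurd ((hpoles α hα h1).trans hle) (not_le.mpr he'γ)
      · intro τ hτ hle
        refine lt_of_le_of_ne hle fun heq' => ?_
        have h1 : A.valuation cβ < A.valuation (τ - s₀) := by rw [heq']; exact hβγ''
        have h2 : A.valuation (τ - s₀) < A.valuation e := by rw [heq']; exact hγe
        exact absurd (hmax τ hτ (lt_trans hβ1 h1) h2) (not_le.mpr h1)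
    rw [← hk₂e]
    exact ⟨by omega, hcoeff₂⟩

end Ascend

section AscendStep

variable {K : Type*} [Field K] [IsAlgClosed K] [CharZero K] (A : ValuationSubring K)
variable {d : ℕ} {p q : K[X]}

/-- **The ascent step.**  Let `(p, q)` be a tame deep Belyi pair with a special point `s₀` in the
unit disc, for which `∞` is NOT a pole of the reduction `redPoly (p - a q)/redPoly q` (`a` the formula
centre).  Let `c' = s' - s₀` point to a nearest special point outside the unit disc.  Then the
rescaled pair on the disc `D(s₀, v c')` (the next cluster disc up) is again deep. [folklore] -/
theorem IsBelyiPair.ascend (h : IsBelyiPair d p q)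
    (htame : ∀ n : ℕ, 0 < n → n ≤ d → (n : ResidueField A) ≠ 0) (hdeep : IsDeepPair A p q)
    (houter : Multiset.card (intRoots A (p - C (centre A p q) * q)) ≤ Multiset.card (intRoots A q))
    {s₀ : K} (hs₀F : s₀ ∈ (p * q * (p - q)).roots) (hs₀A : s₀ ∈ A) :
    ∃ c' : K, 1 < A.valuation c' ∧ s₀ + c' ∈ (p * q * (p - q)).roots ∧
      (∀ s ∈ (p * q * (p - q)).roots, 1 < A.valuation (s - s₀) → A.valuation c' ≤ A.valuation (s - s₀)) ∧
      IsDeepPair A (p.comp (C s₀ + C c' * X)) (q.comp (C s₀ + C c' * X)) := by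
  have hq0 : q ≠ 0 := h.right_ne_zero
  have hp0 : p ≠ 0 := h.left_ne_zero
  have hr0 : p - q ≠ 0 := h.sub_ne_zero
  set a := centre A p q with ha
  -- the chart and `v b < r_Y(a)`
  obtain ⟨b, c₁, gP, gQ, u, hb0, hc₁, hu, hbq, hgPf, hgPr, hgQf, hgQr⟩ := h.exists_chart A
  have hgq : 0 < gaussVal A q := zero_lt_iff.mpr (gaussVal_ne_zero A hq0)
  have hdeepa := h.gaussVal_sub_centre_lt A hdeep
  rw [← ha, ← hbq] at hdeepa
  have hbY : A.valuation b < rY A a := lt_of_mul_lt_mul_right' hdeepa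
  -- outer entering
  obtain ⟨t, ht⟩ := h.outer_entering A hu hgPf hgPr hgQf hgQr houter
  set lam : K := a + b * t with hlam
  set Λ : K[X] := p - C lam * q with hΛ
  have hΛ0 : Λ ≠ 0 := h.sub_C_mul_ne_zero lam
  have hgΛ : gaussVal A Λ = A.valuation b * gaussVal A q := by
    rw [hΛ, hlam, h.gaussVal_shift A hc₁ hgPf hgPr hgQf hgQr t, hbq]
  have hlama : A.valuation (lam - a) ≤ A.valuation b := by
    rw [hlam, add_sub_cancel_left, map_mul]
    exact mul_le_of_le_one_right' (A.valuation_le_one t)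
  -- counts at radius `1` around `s₀`
  set ν := rootsIn A q s₀ 1 with hν
  have hνq : Multiset.card (intRoots A q) = ν := card_intRoots_eq_rootsIn_one A q hs₀A
  have hν0 : 0 < ν := by
    -- `s₀` is an integral root of `p`, `q` or `p - q`, and the three counts agree
    have e1 := IsDeepPair.card_intRoots_left_eq A hdeep
    have e2 := IsDeepPair.card_intRoots_sub_eq A hdeep
    have key : ∀ {f : K[X]}, s₀ ∈ f.roots → 0 < Multiset.card (intRoots A f) := fun hf =>
      Multiset.card_pos_iff_exists_mem.mpr ⟨⟨s₀, hs₀A⟩, (mem_intRoots A).mpr hf⟩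
    rw [← hνq]
    rw [h.roots_prod, Multiset.mem_add, Multiset.mem_add] at hs₀F
    rcases hs₀F with (hs | hs) | hs
    · rw [← e1]; exact key hs
    · exact key hs
    · rw [← e2]; exact key hs
  set k := rootsIn A Λ s₀ 1 with hk
  have hkΛ : Multiset.card (intRoots A Λ) = k := card_intRoots_eq_rootsIn_one A Λ hs₀A
  have hkν : k + 1 ≤ ν := by rw [← hkΛ, ← hνq]; exact ht
  -- a nearest special point outside the unit disc
  obtain ⟨sout, hsoutF, hsoutA⟩ := h.exists_special_not_mem A hdeep
  have hsout1 : 1 < A.valuation (sout - s₀) := by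
    rw [← not_le, ← mem_iff_valuation_sub_le_one A hs₀A]; exact hsoutA
  set Sout := ((p * q * (p - q)).roots.toFinset.filter fun s => 1 < A.valuation (s - s₀)) with hSout
  obtain ⟨s₁, hs₁, hs₁min⟩ := Finset.exists_min_image Sout (fun s => A.valuation (s - s₀))
    ⟨sout, Finset.mem_filter.mpr ⟨Multiset.mem_toFinset.mpr hsoutF, hsout1⟩⟩
  rw [Finset.mem_filter, Multiset.mem_toFinset] at hs₁
  obtain ⟨hs₁F, hs₁gt⟩ := hs₁
  set c' : K := s₁ - s₀ with hc'
  have hc'0 : c' ≠ 0 := by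
    intro h0; rw [h0, map_zero] at hs₁gt; exact (not_lt.mpr zero_le) hs₁gt
  have hspec : ∀ s ∈ (p * q * (p - q)).roots, 1 < A.valuation (s - s₀) →
      A.valuation c' ≤ A.valuation (s - s₀) := fun s hs h1 =>
    hs₁min s (Finset.mem_filter.mpr ⟨Multiset.mem_toFinset.mpr hs, h1⟩)
  have hpoles : ∀ β ∈ q.roots, 1 < A.valuation (β - s₀) → A.valuation c' ≤ A.valuation (β - s₀) := by
    intro β hβ
    refine hspec β ?_
    rw [h.roots_prod]; exact Multiset.mem_add.mpr (Or.inl (Multiset.mem_add.mpr (Or.inr hβ)))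
  have hrq : ∀ {e : K}, 1 ≤ A.valuation e → A.valuation e < A.valuation c' →
      rootsIn A q s₀ (A.valuation e) = ν := by
    intro e he1 heγ
    rw [hν, rootsIn, rootsIn]
    congr 1
    refine Multiset.filter_congr fun β hβ => ⟨fun hle => ?_, fun hle => hle.trans he1⟩
    by_contra hgt
    exact absurd ((hpoles β hβ (not_le.mp hgt)).trans hle) (not_le.mpr heγ)
  -- the edge centre and `P'`
  set aₛ : K := (taylor s₀ p).coeff ν / (taylor s₀ q).coeff ν with haₛ
  set P' : K[X] := p - C aₛ * q with hP'
  have hP'0 : P' ≠ 0 := h.sub_C_mul_ne_zero aₛ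
  have hQν1 : A.valuation ((taylor s₀ q).coeff ν) = gaussVal A q := by
    have := valuation_taylor_coeff_rootsIn (A := A) hq0 (IsAlgClosed.splits q) s₀ one_ne_zero
    rw [map_one, one_pow, mul_one, gaussValAt_one_eq_gaussVal A q hs₀A] at this
    rwa [hν]
  have hΛk1 : A.valuation ((taylor s₀ Λ).coeff k) = A.valuation b * gaussVal A q := by
    have := valuation_taylor_coeff_rootsIn (A := A) hΛ0 (IsAlgClosed.splits Λ) s₀ one_ne_zero
    rw [map_one, one_pow, mul_one, gaussValAt_one_eq_gaussVal A Λ hs₀A, hgΛ] at this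
    rwa [hk]
  -- a radius strictly between `1` and all breakpoints of `Λ` and `v c'`
  obtain ⟨ebot, hebot1, hebotγ, hebotΛ⟩ : ∃ e : K, 1 < A.valuation e ∧ A.valuation e < A.valuation c' ∧
      ∀ τ ∈ Λ.roots, 1 < A.valuation (τ - s₀) → A.valuation e < A.valuation (τ - s₀) := by
    set T := (Λ.roots.toFinset.filter fun τ => 1 < A.valuation (τ - s₀)) with hT
    -- the least relevant radius above `1`
    have hbound : ∃ γ₀ : A.ValueGroup, 1 < γ₀ ∧ γ₀ ≤ A.valuation c' ∧
        ∀ τ ∈ Λ.roots, 1 < A.valuation (τ - s₀) → γ₀ ≤ A.valuation (τ - s₀) := by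
      by_cases hTe : T.Nonempty
      · obtain ⟨τ₁, hτ₁, hτ₁min⟩ := Finset.exists_min_image T (fun τ => A.valuation (τ - s₀)) hTe
        rw [Finset.mem_filter, Multiset.mem_toFinset] at hτ₁
        refine ⟨min (A.valuation c') (A.valuation (τ₁ - s₀)), lt_min hs₁gt hτ₁.2, min_le_left _ _,
          fun τ hτ h1 => (min_le_right _ _).trans ?_⟩
        exact hτ₁min τ (Finset.mem_filter.mpr ⟨Multiset.mem_toFinset.mpr hτ, h1⟩)
      · refine ⟨A.valuation c', hs₁gt, le_rfl, fun τ hτ h1 => ?_⟩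
        exact absurd ⟨τ, Finset.mem_filter.mpr ⟨Multiset.mem_toFinset.mpr hτ, h1⟩⟩ hTe
    obtain ⟨γ₀, hγ₀1, hγ₀c, hγ₀Λ⟩ := hbound
    obtain ⟨γ, h1γ, hγγ₀⟩ := exists_between_of_lt A one_ne_zero hγ₀1
    obtain ⟨e, he⟩ := A.valuation_surjective γ
    rw [← he] at h1γ hγγ₀
    exact ⟨e, h1γ, lt_of_lt_of_le hγγ₀ hγ₀c, fun τ hτ h1 => lt_of_lt_of_le hγγ₀ (hγ₀Λ τ hτ h1)⟩
  have hebot0 : ebot ≠ 0 := by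
    intro h0; rw [h0, map_zero] at hebot1; exact (not_lt.mpr zero_le) hebot1
  have hrΛ : rootsIn A Λ s₀ (A.valuation ebot) = k := by
    rw [hk, rootsIn, rootsIn]
    congr 1
    refine Multiset.filter_congr fun τ hτ => ⟨fun hle => ?_, fun hle => hle.trans hebot1.le⟩
    by_contra hgt
    exact absurd (hebotΛ τ hτ (not_le.mp hgt)) (not_lt.mpr hle)
  -- optimality of `aₛ` at `v ebot`: `|P'| ≤ |Λ| < v b |q|`
  set Lb : K[X] := C s₀ + C ebot * X with hLb
  have hpairb := h.comp s₀ hebot0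
  have hcentreb : centre A (p.comp Lb) (q.comp Lb) = aₛ := by
    rw [hLb, centre_comp A p q s₀ hebot0, hrq hebot1.le hebotγ]
  have hopt := (hpairb.optimal_centre A rfl rfl).1 lam
  rw [← centre, hcentreb, ← sub_C_mul_comp, ← sub_C_mul_comp, ← hP', ← hΛ] at hopt
  have hGqb : gaussVal A (q.comp Lb) = A.valuation ((taylor s₀ q).coeff ν) * A.valuation ebot ^ ν := by
    rw [hLb, gaussVal_comp, ← hrq hebot1.le hebotγ]
    exact (valuation_taylor_coeff_rootsIn hq0 (IsAlgClosed.splits q) s₀ hebot0).symm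
  have hGΛb : gaussVal A (Λ.comp Lb) = A.valuation ((taylor s₀ Λ).coeff k) * A.valuation ebot ^ k := by
    rw [hLb, gaussVal_comp, ← hrΛ]
    exact (valuation_taylor_coeff_rootsIn hΛ0 (IsAlgClosed.splits Λ) s₀ hebot0).symm
  have hΛlt : gaussVal A (Λ.comp Lb) < A.valuation b * gaussVal A (q.comp Lb) := by
    rw [hGΛb, hGqb, hΛk1, ← hQν1, mul_assoc]
    refine mul_lt_mul_of_pos_left ?_ (zero_lt_iff.mpr ((Valuation.ne_zero_iff _).mpr hb0))
    refine mul_lt_mul_of_pos_left (pow_lt_pow_right₀ hebot1 (by omega)) ?_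
    rw [hQν1]; exact hgq
  have haₛlam : A.valuation (aₛ - lam) < A.valuation b := by
    have e : C (aₛ - lam) * q.comp Lb = Λ.comp Lb - P'.comp Lb := by
      rw [hΛ, hP', sub_C_mul_comp, sub_C_mul_comp, map_sub]; ring
    have : A.valuation (aₛ - lam) * gaussVal A (q.comp Lb) < A.valuation b * gaussVal A (q.comp Lb) := by
      rw [← gaussVal_C_mul, e]
      exact lt_of_le_of_lt ((gaussVal_sub_le A _ _).trans (max_le le_rfl hopt)) hΛlt
    exact lt_of_mul_lt_mul_right' this
  -- perturbation at the unit disc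
  have hpert : gaussVal A (C (lam - aₛ) * q) < gaussVal A Λ := by
    rw [gaussVal_C_mul, hgΛ, ← Valuation.map_neg, neg_sub]
    exact mul_lt_mul_of_pos_right haₛlam hgq
  have hP'Λ : P' = Λ + C (lam - aₛ) * q := by rw [hP', hΛ, map_sub]; ring
  have hkP' : rootsIn A P' s₀ 1 = k := by
    rw [← card_intRoots_eq_rootsIn_one A P' hs₀A, hP'Λ,
      card_intRoots_add_of_gaussVal_lt (IsAlgClosed.splits _) (IsAlgClosed.splits _) hpert, hkΛ]
  have hgP' : gaussVal A P' = A.valuation b * gaussVal A q := by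
    rw [hP'Λ, gaussVal_add_of_gaussVal_lt hpert, hgΛ]
  have hθ : A.valuation ((taylor s₀ P').coeff k) ≤ A.valuation b * A.valuation ((taylor s₀ q).coeff ν) := by
    have := valuation_taylor_coeff_rootsIn (A := A) hP'0 (IsAlgClosed.splits P') s₀ one_ne_zero
    rw [map_one, one_pow, mul_one, gaussValAt_one_eq_gaussVal A P' hs₀A, hgP', hkP'] at this
    rw [this, hQν1]
  have hrYₛ : rY A aₛ = rY A a := by
    apply rY_eq_of_valuation_sub_lt
    have : aₛ - a = (aₛ - lam) + (lam - a) := by ring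
    rw [this]
    exact lt_of_le_of_lt (A.valuation.map_add _ _) (max_lt (lt_trans haₛlam hbY) (lt_of_le_of_lt hlama hbY))
  have hθY : A.valuation b < rY A aₛ := by rw [hrYₛ]; exact hbY
  -- the upward edge invariant at the top radius `v c'`
  obtain ⟨hk', hcoeff'⟩ := h.edge_invariant_up A htame hspec hν hν0 haₛ (k := k) hkP'.symm hkν hθ hθY
    hs₁gt le_rfl
  set k' := rootsInOpen A P' s₀ (A.valuation c') with hk'def
  -- the new pair is deep
  set L' : K[X] := C s₀ + C c' * X with hL'
  have hP'L' : p.comp L' - C aₛ * q.comp L' = P'.comp L' := (sub_C_mul_comp p q aₛ L').symm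
  have hGP' : gaussVal A (P'.comp L') = A.valuation ((taylor s₀ P').coeff k') * A.valuation c' ^ k' := by
    rw [hL', gaussVal_comp, hk'def]
    exact (valuation_taylor_coeff_rootsInOpen hP'0 (IsAlgClosed.splits P') s₀ hc'0).symm
  have hGq : A.valuation ((taylor s₀ q).coeff ν) * A.valuation c' ^ ν ≤ gaussVal A (q.comp L') := by
    rw [hL', gaussVal_comp]; exact valuation_taylor_coeff_mul_le_gaussValAt q s₀ _ ν
  have hQν0 : 0 < A.valuation ((taylor s₀ q).coeff ν) := by rw [hQν1]; exact hgq
  have hvc' : 0 < A.valuation c' := lt_trans zero_lt_one hs₁gt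
  have hdeep' : gaussVal A (P'.comp L') < rY A aₛ * gaussVal A (q.comp L') := by
    rw [hGP']
    have hlt1 : A.valuation c' ^ k' < A.valuation c' ^ ν := pow_lt_pow_right₀ hs₁gt (by omega)
    have hbpos : 0 < A.valuation b := zero_lt_iff.mpr ((Valuation.ne_zero_iff _).mpr hb0)
    calc A.valuation ((taylor s₀ P').coeff k') * A.valuation c' ^ k'
        ≤ A.valuation b * A.valuation ((taylor s₀ q).coeff ν) * A.valuation c' ^ k' :=
          mul_le_mul' hcoeff' le_rfl
      _ < A.valuation b * A.valuation ((taylor s₀ q).coeff ν) * A.valuation c' ^ ν :=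
          mul_lt_mul_of_pos_left hlt1 (mul_pos hbpos hQν0)
      _ = A.valuation b * (A.valuation ((taylor s₀ q).coeff ν) * A.valuation c' ^ ν) := by rw [mul_assoc]
      _ ≤ A.valuation b * gaussVal A (q.comp L') := mul_le_mul' le_rfl hGq
      _ < rY A aₛ * gaussVal A (q.comp L') := by
          refine mul_lt_mul_of_pos_right hθY ?_
          exact zero_lt_iff.mpr (gaussVal_ne_zero A (comp_C_add_C_mul_X_ne_zero hq0 s₀ hc'0))
  refine ⟨c', hs₁gt, ?_, hspec, ⟨aₛ, by rw [hP'L']; exact hdeep'⟩⟩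
  rw [hc', add_sub_cancel]; exact hs₁F

end AscendStep

end Literature.NumberTheory.DiophantineGeometry

end
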